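import Summits.QuantumFields.YangMills.Theorems.BalabanUVNodesC44IterMhAtRecord
import Literature.MathematicalPhysics.QuantumFieldTheory.Balaban1983to89.LatticeWordStokes
import HarnessLib

/-!
# (ℓa-C) ROAD B, FILE F6 — THE LETTER FROM PRINT'S REGULARITY HYPOTHESIS (14): `U₀ ∈ U_k({Ω_j}, α)` (small plaquettes AT ALL SCALES, area law
# `α·(L^jη)²`) ⇒ the (0.4) guard AND the summable loop profile of F5 ⇒ `Prop4LetterCAtRecord` (small-field approximation `Ω_k = T`)

Cell `pub-ymgap` ∕ `ym-nodeO-ideate`, porter lineage `ymgap-nodeO-port-PTB-1` (gen 7), hand «(44) for `iterMh`» (director-ym g22 №569/№571; PORT-PLAN-v5 dc7ff9950b0ac185, § F5 sequel).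
`--kind proof --supports stmt-QuantumFields-27238 --as helper`; count-neutral.  [B7] = [Balaban1985Averaging]; [B11] = [Balaban1985Variational]; [B8] = [Balaban1985RegularSpaces];
[I] = [Balaban1987RG1].

WHY.  F5 ✓`prop4LetterCAtRecord_of_loopProfile` carries two DISPLAYED background hypotheses: the (0.4) guard `SmallBelow` and a summable LOOP PROFILE of the real tower
`Ū^j(U₀)` (`‖Ū^j(U₀)(loop) − 1‖ ≤ ε_j`, `ε_j ≤ 1∕50`, `N·ε_j ≤ 2`, `3·10⁵·Σ_{j<k}ε_j ≤ 1∕4`).  Print's hypothesis on the background is [B11] (14): `U₀ ∈ U_k({Ω_j}, C₁B₃ε₁)`, the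
space (2) of [B8]∕[B11] — «`|Ū^j(U₀)(∂p) − 1| < ε·(L^jη)²` for the plaquettes `p` of the `L^jη`-lattice in `Ω_j`, `j = 0, …, k`» — i.e. SMALL PLAQUETTES AT ALL SCALES with the
AREA LAW `(L^jη)² = L^{2(j−k)}`: GEOMETRIC FROM THE TOP.  THIS FILE derives both F5 hypotheses from (14) (top-level profile, tree predicate `PlaqSmall`): the crude non-abelian
Stokes bound of the tree (✓`LatticeWordStokes.dist1_loopHol_le`: every (0.4) loop variable is within `(((d+2)L)²∕4)·δ` of `1` under `PlaqSmall δ`) gives `ε_j = 9L²·α(L^jη_k)²`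
(`d = 4`), hence `ε_j ≤ 9α`, `Σ_{j<k} ε_j ≤ 9α·L²∕(L² − 1) ≤ 9α·144∕143`, and the guard by ✓`LatticeWordStokes.small_of_plaqSmall` (`9α < δ_N = min(1∕3, π∕N)`); ONE smallness number
`α ≤ a₁(N) := (1.1·10⁷·N)⁻¹` (print: «ε₁ ≤ a₁», constants depending on `d, L` — here on `N` through the `SU(N)` guard of the printed `exp[mean log]`).

WHAT IS PROVED (0 def, 0 sorry, axioms standard; ns `Summit.QuantumFields.YangMills.Theorems.C44IterMh`).
* `norm_loopM_coeField_sub_one_le_of_plaqSmall` — (0.4) loops from plaquettes (matrix reading of ✓`dist1_loopHol_le`).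
* `smallBelow_of_plaqProfile` — the (0.4) guard below `k` from a plaquette profile `a_j` with `(((d+2)L)²∕4)·a_j < δ_N`.
* `sum_range_weightSq_le` — the area law summed from the top: `Σ_{j<k} (L^jη_k)² ≤ 1∕(L² − 1)`·(bookkeeping form `L²η_k²·((L²)^k − 1)∕(L² − 1) ≤ L²∕(L² − 1)`).
* ★★★ `prop4LetterCAtRecord_of_regular` — `(∀ x, x ∈ Ω_k) → 0 ≤ α → α·(1.1·10⁷·N) ≤ 1 → (∀ j<k, PlaqSmall (α(L^jη_k)²) (Ū^j U₀)) → Prop4LetterCAtRecord … (1.28·10¹⁶LN) (2·10¹¹LN)⁻¹`.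
* ★ `prop4UniformAtRecord_of_letters_regular` — the door with the (ℓa-C) slot so filled.

HONEST FRAMING.  The hypothesis is print's (14) in the SMALL-FIELD APPROXIMATION ONLY (`Ω_j = T`: no large-field regions; PORT-PLAN-v5 (F-β)); levels `j < k` suffice here
(print asks `j ≤ k`).  (ℓa-H)(ℓd) remain DISPLAYED; (R1)∕(R2) OPEN; K0ᴬ ⟨stmt-QuantumFields-27238⟩ NOT closed; K0ᴬ∕K1ᴬ∕K3ᴬ 0∕3; NODE O 0∕1; COUNT 8∕28 · K 1∕4 UNMOVED;
finite `𝕋⁴_{L^K}` at fixed ε — NOT continuum ∕ ℝ⁴ ∕ OS; **the Yang–Mills mass gap (Clay) is NOT proved by any of this.**  No `sorry`, `instance`, `notation`, `set_option`.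
-/

noncomputable section

open scoped Matrix Matrix.Norms.L2Operator InnerProductSpace ComplexConjugate Topology

namespace Summit.QuantumFields.YangMills.Theorems.C44IterMh

open Literature.MathematicalPhysics.QuantumFieldTheory.Balaban1983to89
open Literature.MathematicalPhysics.QuantumFieldTheory.Balaban1983to89.Node00
open T4Continuum BlockAveraging
open LatticeWordStokes (dist1_loopHol_le small_of_plaqSmall)
open ExpMeanLog (expMeanLogSU deltaSU)
open B11Eq103H1Complex (SiteL2K)

/-! ## §1  Generic: (0.4) loops and the guard from small plaquettes -/

section Generic

variable {P : Params} {N : ℕ} [NeZero N]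

/-- **(0.4) LOOPS FROM PLAQUETTES** (matrix reading): under `PlaqSmall δ U`, `‖U(loop_{c,i}) − 1‖ ≤ (((d+2)L)²∕4)·δ` — the crude non-abelian Stokes bound for the closed
(0.4) words. [cite: Balaban1985Averaging, (19)–(20) p.21; Balaban1987RG1, (0.4) p.253, (0.18) p.255] -/
theorem norm_loopM_coeField_sub_one_le_of_plaqSmall {j : ℕ} {δ : ℝ} (hδ : 0 ≤ δ) {U : GaugeField P j (SU N)} (hU : PlaqSmall δ U)
    (c : PBond P (j + 1)) (i : Idx P) :
    ‖loopM (coeField U) c i - 1‖ ≤ ((((P.d + 2) * P.L : ℕ) : ℝ) ^ 2 / 4) * δ := by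
  rw [← coe_loopHol]
  exact dist1_loopHol_le hδ hU c i

/-- **THE (0.4) GUARD BELOW `k` FROM A PLAQUETTE PROFILE**: if every `Ū^j(U₀)`, `j < k`, has plaquettes within `a_j` of `1` and `(((d+2)L)²∕4)·a_j < δ_N`, then
`SmallBelow av k U₀` — the LEVEL-DEPENDENT (profile) edition of ✓`N07CritTangentConverse.smallBelow_of_plaqSmall` (constant `t₀`); the constant is
✓`UnitScaleTiltBlockAvgCorrector.stokesConst P` spelled out. [cite: Balaban1987RG1, (0.4) p.253, (0.18)–(0.21) pp.255–256] -/
theorem smallBelow_of_plaqProfile (av : ∀ j, Averaging P j (SU N)) (k : ℕ) (U₀ : GaugeField P 0 (SU N)) {a : ℕ → ℝ} (ha0 : ∀ j, 0 ≤ a j)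
    (hreg : ∀ j, j < k → PlaqSmall (a j) (Averaging.iter av j U₀))
    (ha : ∀ j, j < k → ((((P.d + 2) * P.L : ℕ) : ℝ) ^ 2 / 4) * a j < deltaSU (Fin N)) :
    SmallBelow av k U₀ :=
  fun j hj c => small_of_plaqSmall expMeanLogSU (ha0 j) (hreg j hj) (ha j hj) c

end Generic

/-! ## §2  At the record: the area law summed from the top, and the letter from (14) -/

section Record

variable (F : T4Family) (N : ℕ) [NeZero N] {K : ℕ} (k : ℕ) (Ω : ℕ → Set (Site (F.P K) 0)) (U₀ : GaugeField (F.P K) 0 (SU N))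

omit [NeZero N] in
/-- **THE AREA LAW SUMMED FROM THE TOP**: `L²η_k²·((L²)^k − 1)∕(L² − 1) ≤ L²∕(L² − 1)` (`L^kη_k = 1`), i.e. `Σ_{j<k} L²(L^jη_k)² ≤ L²∕(L² − 1)`.
[cite: Balaban1985Variational, (2) p.278, (14) p.280 (bookkeeping)] -/
theorem sum_range_weightSq_le :
    (Finset.range k).sum (fun j => (F.L : ℝ) ^ 2 * ((F.L : ℝ) ^ j * (F.P K).eta k) ^ 2) ≤ (F.L : ℝ) ^ 2 / ((F.L : ℝ) ^ 2 - 1) := by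
  have hL12 : (12 : ℝ) ≤ F.L := by exact_mod_cast F.hL11
  have hw1 : (F.L : ℝ) ^ k * (F.P K).eta k = 1 := L_pow_mul_eta_real F k
  have hq1 : (1 : ℝ) < (F.L : ℝ) ^ 2 := by nlinarith
  have hpos : 0 < (F.L : ℝ) ^ 2 - 1 := by linarith
  have hterm : ∀ j, (F.L : ℝ) ^ 2 * ((F.L : ℝ) ^ j * (F.P K).eta k) ^ 2 = (F.L : ℝ) ^ 2 * ((F.P K).eta k) ^ 2 * ((F.L : ℝ) ^ 2) ^ j := by
    intro j; ring
  simp_rw [hterm]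
  rw [← Finset.mul_sum, geom_sum_eq hq1.ne']
  have hηk : ((F.P K).eta k) ^ 2 * ((F.L : ℝ) ^ 2) ^ k = 1 := by
    calc ((F.P K).eta k) ^ 2 * ((F.L : ℝ) ^ 2) ^ k = ((F.L : ℝ) ^ k * (F.P K).eta k) ^ 2 := by ring
      _ = 1 := by rw [hw1, one_pow]
  have hnum : (F.L : ℝ) ^ 2 * ((F.P K).eta k) ^ 2 * (((F.L : ℝ) ^ 2) ^ k - 1) ≤ (F.L : ℝ) ^ 2 := by
    have h : (F.L : ℝ) ^ 2 * ((F.P K).eta k) ^ 2 * (((F.L : ℝ) ^ 2) ^ k - 1) = (F.L : ℝ) ^ 2 - (F.L : ℝ) ^ 2 * ((F.P K).eta k) ^ 2 := by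
      calc (F.L : ℝ) ^ 2 * ((F.P K).eta k) ^ 2 * (((F.L : ℝ) ^ 2) ^ k - 1)
          = (F.L : ℝ) ^ 2 * (((F.P K).eta k) ^ 2 * ((F.L : ℝ) ^ 2) ^ k) - (F.L : ℝ) ^ 2 * ((F.P K).eta k) ^ 2 := by ring
        _ = (F.L : ℝ) ^ 2 - (F.L : ℝ) ^ 2 * ((F.P K).eta k) ^ 2 := by rw [hηk, mul_one]
    rw [h]
    nlinarith [sq_nonneg ((F.P K).eta k), sq_nonneg (F.L : ℝ)]
  rw [div_eq_mul_inv, div_eq_mul_inv, ← mul_assoc]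
  exact mul_le_mul_of_nonneg_right hnum (inv_nonneg.2 hpos.le)

/-- ★★★ **[B11] (44) ∕ PROP. 4's (ℓa-C) LETTER AT THE RECORD FROM PRINT'S REGULARITY (14), SMALL-FIELD APPROXIMATION**: if every site lies in `Ω_k` and the background tower has
SMALL PLAQUETTES AT ALL SCALES `j < k` with the area law — `PlaqSmall (α·(L^jη_k)²) (Ū^j U₀)`, i.e. `U₀ ∈ U_k({T}, α)` of [B8] (2) — for one number `0 ≤ α ≤ (1.1·10⁷·N)⁻¹`, then
`Prop4LetterCAtRecord F N K k Ω U₀ levB (1.28·10¹⁶·L·N) ((2·10¹¹·L·N)⁻¹)`: `‖C^{𝔰𝔩}(A′)‖ ≤ C₂‖A′‖²` and ℂ-differentiability on `‖A′‖ < c₄`, `(C₂, c₄)` k-FREE.  The guard (0.4) and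
F5's loop profile `ε_j = 9L²α(L^jη_k)²` are DERIVED (✓`small_of_plaqSmall`, ✓`dist1_loopHol_le`, `Σ_{j<k}ε_j ≤ 9α·144∕143`).
[cite: Balaban1985Variational, (14) p.280, (2) p.278, (44) p.285, Prop. 4 (97)–(98) pp.292–293; Balaban1987RG1, (0.4) p.253, (0.18) p.255; Balaban1985Averaging, (19)–(20) p.21] -/
theorem prop4LetterCAtRecord_of_regular [Fact (0 < (F.L : ℝ))] [Fact (0 < (F.P K).eta k)] [Fact (0 < c0Rec F K k)] [Fact (∀ c, 0 < wBRec F K k c)]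
    (levB : PBond (F.P K) k → ℕ) (hΩ : ∀ x, x ∈ Ω k) {α : ℝ} (hα0 : 0 ≤ α) (hα : α * (11000000 * N) ≤ 1)
    (hreg : ∀ j, j < k → PlaqSmall (α * ((F.L : ℝ) ^ j * (F.P K).eta k) ^ 2) (Averaging.iter (avOfRecord F N K) j U₀)) :
    Prop4LetterCAtRecord F N K k Ω U₀ levB (12800000000000000 * (F.L : ℝ) * N) (1 / (200000000000 * (F.L : ℝ) * N)) := by
  -- constants and casts
  have hN1 : (1 : ℝ) ≤ N := by exact_mod_cast Nat.one_le_iff_ne_zero.2 (NeZero.ne N)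
  have hL12 : (12 : ℝ) ≤ F.L := by exact_mod_cast F.hL11
  have hL1 : (1 : ℝ) ≤ F.L := by linarith
  have hη0 : 0 < (F.P K).eta k := Fact.out
  have hw1 : (F.L : ℝ) ^ k * (F.P K).eta k = 1 := L_pow_mul_eta_real F k
  have hαs : α ≤ 1 / 11000000 := by
    rw [le_div_iff₀ (by norm_num)]
    nlinarith [mul_le_mul_of_nonneg_left hN1 (by positivity : (0 : ℝ) ≤ α * 11000000)]
  have hαN : α * N ≤ 1 / 11000000 := by
    rw [le_div_iff₀ (by norm_num)]
    linarith
  have hS : ((((F.P K).d + 2) * (F.P K).L : ℕ) : ℝ) ^ 2 / 4 = 9 * (F.L : ℝ) ^ 2 := by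
    rw [T4Family.P_d, T4Family.P_L]; push_cast; ring
  -- the weights `(L^jη_k)²·L² ≤ 1` for `j < k`
  have hwj : ∀ j, j < k → (F.L : ℝ) ^ 2 * ((F.L : ℝ) ^ j * (F.P K).eta k) ^ 2 ≤ 1 := by
    intro j hj
    have h1 : (F.L : ℝ) ^ (j + 1) * (F.P K).eta k ≤ 1 := by
      rw [← hw1]; exact mul_le_mul_of_nonneg_right (pow_le_pow_right₀ hL1 hj) hη0.le
    have h0 : 0 ≤ (F.L : ℝ) ^ (j + 1) * (F.P K).eta k := by positivity
    calc (F.L : ℝ) ^ 2 * ((F.L : ℝ) ^ j * (F.P K).eta k) ^ 2 = ((F.L : ℝ) ^ (j + 1) * (F.P K).eta k) ^ 2 := by ring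
      _ ≤ 1 := pow_le_one₀ h0 h1
  -- the loop profile `ε_j := 9L²·α(L^jη_k)²`
  have hδ0 : ∀ j, 0 ≤ α * ((F.L : ℝ) ^ j * (F.P K).eta k) ^ 2 := fun j => mul_nonneg hα0 (sq_nonneg _)
  have hεj : ∀ j, j < k → 9 * (F.L : ℝ) ^ 2 * (α * ((F.L : ℝ) ^ j * (F.P K).eta k) ^ 2) ≤ 9 * α := by
    intro j hj
    have h := mul_le_mul_of_nonneg_left (hwj j hj) (mul_nonneg (by norm_num : (0 : ℝ) ≤ 9) hα0)
    calc 9 * (F.L : ℝ) ^ 2 * (α * ((F.L : ℝ) ^ j * (F.P K).eta k) ^ 2) = 9 * α * ((F.L : ℝ) ^ 2 * ((F.L : ℝ) ^ j * (F.P K).eta k) ^ 2) := by ring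
      _ ≤ 9 * α * 1 := h
      _ = 9 * α := mul_one _
  have hguard : ∀ j, j < k → ((((F.P K).d + 2) * (F.P K).L : ℕ) : ℝ) ^ 2 / 4 * (α * ((F.L : ℝ) ^ j * (F.P K).eta k) ^ 2) < deltaSU (Fin N) := by
    intro j hj
    rw [hS, ExpMeanLog.deltaSU, Fintype.card_fin]
    refine lt_of_le_of_lt (hεj j hj) (lt_min (by linarith) ?_)
    rw [lt_div_iff₀ (by positivity)]
    nlinarith [Real.pi_gt_three]
  have hU₀ : SmallBelow (avOfRecord F N K) k U₀ := smallBelow_of_plaqProfile (avOfRecord F N K) k U₀ hδ0 hreg hguard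
  -- the sum from the top
  have hsum : (Finset.range k).sum (fun j => 9 * (F.L : ℝ) ^ 2 * (α * ((F.L : ℝ) ^ j * (F.P K).eta k) ^ 2)) ≤ 9 * α * (144 / 143) := by
    have hterm : ∀ j, 9 * (F.L : ℝ) ^ 2 * (α * ((F.L : ℝ) ^ j * (F.P K).eta k) ^ 2) = 9 * α * ((F.L : ℝ) ^ 2 * ((F.L : ℝ) ^ j * (F.P K).eta k) ^ 2) := by
      intro j; ring
    simp_rw [hterm]
    rw [← Finset.mul_sum]
    have hpos : 0 < (F.L : ℝ) ^ 2 - 1 := by nlinarith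
    have hratio : (F.L : ℝ) ^ 2 / ((F.L : ℝ) ^ 2 - 1) ≤ 144 / 143 := by
      rw [div_le_div_iff₀ hpos (by norm_num)]
      nlinarith
    exact mul_le_mul_of_nonneg_left ((sum_range_weightSq_le F k).trans hratio) (mul_nonneg (by norm_num) hα0)
  -- F5
  refine prop4LetterCAtRecord_of_loopProfile F N k Ω U₀ levB hU₀ hΩ (fun j => 9 * (F.L : ℝ) ^ 2 * (α * ((F.L : ℝ) ^ j * (F.P K).eta k) ^ 2))
    (fun j => mul_nonneg (by positivity) (hδ0 j)) (fun j hj c i => ?_) (fun j hj => ?_) (fun j hj => ?_) ?_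
  · have h := norm_loopM_coeField_sub_one_le_of_plaqSmall (hδ0 j) (hreg j hj) c i
    rw [hS] at h
    exact h
  · exact (hεj j hj).trans (by linarith)
  · calc (N : ℝ) * (9 * (F.L : ℝ) ^ 2 * (α * ((F.L : ℝ) ^ j * (F.P K).eta k) ^ 2)) ≤ N * (9 * α) := mul_le_mul_of_nonneg_left (hεj j hj) (by positivity)
      _ = 9 * (α * N) := by ring
      _ ≤ 2 := by linarith
  · linarith

end Record

/-! ## §3  Through the door with the (ℓa-C) slot filled from (14) -/

section Door

variable (F : T4Family) (N : ℕ) [NeZero N] (K k : ℕ) (Ω : ℕ → Set (Site (F.P K) 0)) (U₀ : GaugeField (F.P K) 0 (SU N))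

/-- ★ **PROP. 4 AT THE RECORD WITH THE (ℓa-C) SLOT FILLED FROM (14)** (small-field approximation): node00-def-Y's door ✓`prop4UniformAtRecord_of_letters_of_norm_J_le` with
`hC := prop4LetterCAtRecord_of_regular`; (ℓa-H), (ℓa-num) at `(C₂, c₄) = (1.28·10¹⁶·L·N, (2·10¹¹·L·N)⁻¹)`, (ℓb), (ℓc), (ℓd), `‖J‖ ≤ nJ` stay HYPOTHESES.  Glue.
[cite: Balaban1985Variational, Prop. 4 (97)–(98) pp.292–293, (14) p.280, (44) p.285] -/
theorem prop4UniformAtRecord_of_letters_regular [Fact (0 < (F.L : ℝ))] [Fact (0 < (F.P K).eta k)] [Fact (0 < c0Rec F K k)] [Fact (∀ c, 0 < wBRec F K k c)]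
    (levB : PBond (F.P K) k → ℕ) (a : ℝ)
    (hpos : ∀ x, x ≠ 0 → 0 < RCLike.re ⟪x, laplaceAOfRecord F N k U₀ (QOfRecord F N k U₀) (QflatOfRecord F N k) a x⟫_ℂ)
    (hQ : Function.Surjective (QOfRecord F N k U₀)) {εC : ℝ}
    (Gp : SiteL2K ℂ (F.P K).d (fun _ => (F.P K).sitesPerDir 0) (c0Rec F K k) (WRec N) →ₗ[ℂ]
      SiteL2K ℂ (F.P K).d (fun _ => (F.P K).sitesPerDir 0) (c0Rec F K k) (WRec N))
    {b aC CV RV R' θ₃ θE θE' N₁ nJ : ℝ}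
    (hΩ : ∀ x, x ∈ Ω k) {α : ℝ} (hα0 : 0 ≤ α) (hα : α * (11000000 * N) ≤ 1)
    (hreg : ∀ j, j < k → PlaqSmall (α * ((F.L : ℝ) ^ j * (F.P K).eta k) ^ 2) (Averaging.iter (avOfRecord F N K) j U₀))
    (hH : Prop4LetterHAtRecord F N K k Ω U₀ levB a hpos hQ b)
    (hnum : Prop4LetterNum b (12800000000000000 * (F.L : ℝ) * N) (1 / (200000000000 * (F.L : ℝ) * N)) aC εC RV R')
    (hV : Prop4LetterV0AtRecord F N K k Ω U₀ CV RV) (hsym : Prop4LetterSymmAtRecord F N K k Ω U₀ Gp)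
    (hcol : Prop4LetterColumnsAtRecord F N K k Ω U₀ levB a hpos hQ εC Gp R' θ₃ θE θE' N₁) (hJ : ‖JOfRecordAtBg F N K k Ω U₀‖ ≤ nJ) :
    Prop4UniformAtRecord F N K k Ω U₀ levB a hpos hQ εC Gp (c4OfRecord N nJ b (12800000000000000 * (F.L : ℝ) * N) εC aC CV R' θ₃ θE θE' N₁) R' :=
  prop4UniformAtRecord_of_letters_of_norm_J_le F N K k Ω U₀ levB a hpos hQ Gp hH
    (prop4LetterCAtRecord_of_regular F N k Ω U₀ levB hΩ hα0 hα hreg) hnum hV hsym hcol hJ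

end Door

end Summit.QuantumFields.YangMills.Theorems.C44IterMh

end
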